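import Summits.KontsevichZagierPeriods.KontsevichZagierPeriods.Theorems.RootDecompWalshStrataEtypeClosed
import Summits.KontsevichZagierPeriods.KontsevichZagierPeriods.Theorems.RootDecompWalshStrataQuadricRung
import Summits.KontsevichZagierPeriods.KontsevichZagierPeriods.Theorems.HurwitzMicroSectorsNormalFormPrincipleDimOneAssembly

/-!
# Root decomposition (Walsh strata), part 65 — the rung `d ≤ 3` of the quadric stratum holds (gen 10, §65)

Route `RootDecompWalshStrata`, support item `QuadricThree` (stmt-KontsevichZagierPeriods-27596): a vanishing
`ℤ`-combination of values of weighted quadric Walsh cells `(0,1)^{dᵢ} ∩ {Pᵢ > 0}`, `deg Pᵢ ≤ 2`, `dᵢ ≤ 3`,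
constant rational integrands, is a Kontsevich–Zagier relation.  It is the landed reduction
`QuadricRung.quadricThree_of_bakerKernel_of_bakerDescent : BakerKernel → QuadricBakerDescent → QuadricThree`
fed with the TREE theorem `PiBox.Dlog.mem_relations_of_eval_eq_zero_of_dim_le_one` (Conjecture 1 in dimension
`≤ 1`, kernel form — Baker) and the now PROVED leaf `quadricBakerDescent_holds` (part 64).
[Baker1975 Thm 2.1; KontsevichZagier2001 §1.2; this node]
-/

namespace Summit.KontsevichZagierPeriods.RootDecompWalshStrata.QuadricRung

/-- **THE RUNG `d ≤ 3` OF THE QUADRIC STRATUM HOLDS** (stmt-KontsevichZagierPeriods-27596): every weighted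
quadric Walsh cell of dimension `≤ 3` descends to the Baker sector (`quadricBakerDescent_holds`), whose
vanishing `ℤ`-combinations are relations by Baker's theorem in the kernel form
`PiBox.Dlog.mem_relations_of_eval_eq_zero_of_dim_le_one`. [Baker1975 Thm 2.1; KontsevichZagier2001 §1.2] -/
theorem quadricThree_holds :
    Summit.KontsevichZagierPeriods.KontsevichZagierPeriods.Theses.RootDecompWalshStrata.QuadricThree :=
  quadricThree_of_bakerKernel_of_bakerDescent
    (fun _ hx hv =>
      Summit.KontsevichZagierPeriods.HurwitzMicroSectors.NormalFormPrinciple.PiBox.Dlog.mem_relations_of_eval_eq_zero_of_dim_le_one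
        hx hv)
    Summit.KontsevichZagierPeriods.RootDecompWalshStrata.ConicDescent.BallCube.quadricBakerDescent_holds

end Summit.KontsevichZagierPeriods.RootDecompWalshStrata.QuadricRung
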